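import Summits.CriticalPhenomena.PercolationContinuityZ3.Theorems.PercNearOneGluingNoHeavyPcintMemoryFourRecursion
import HarnessLib

/-!
# CriticalPhenomena/PercolationContinuityZ3 — Theorems/PercNearOneGluingNoHeavyPcintMemorySixDeficit.lean: combinatorics for STRICT monotonicity at the second rung — the Fisher–Sykes recursion RESTRICTED to words with a prescribed prefix, and the HEXAGON CONTINUATION every memory-4 word admits but memory 6 forbids

Lane prim-pcint, STRUCTURE rule; lemma file for …PcintMemorySixStrict (`μ_6(d) < μ_4(d)` for every `d ≥ 2`, i.e.
`Δ_6(d) > 0`, `R_6(d) > 0`: the lower half of the typed window `loopCompatWindow` of C4 at the SECOND rung — the clause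
the typed file …PcintLoopExclusionLaw calls "the first genuinely open one", Kesten-type strict monotonicity of the
memory hierarchy, here for `τ = 6` against `τ = 4`).

THE METHOD.  Memory-6 words are memory-4 words (`memWords d 6 n ⊆ memWords d 4 n = memFourWords d n`).  The three
Fisher–Sykes end classes `A` (straight), `B` (turn, not a U-turn), `C` (U-turn) of memory-4 words
(Literature …SAWFisherSykesBound; …PcintMemoryFourRecursion) satisfy the UPPER count recursion
`A' ≤ A + B + C`, `C' ≤ B`, `B' ≤ (2d−2)A + (2d−3)(B + C)` — and they satisfy it RESTRICTED TO ANY SET `S` OF PREFIXES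
(`card_endA_succ_filter_le`, `card_endC_succ_filter_le`, `card_endB_succ_filter_le` below: the one-step extensions of the
words of `S`, sorted by end class, against the class counts of `S`).  Weighting the classes by the positive left
Perron vector of the recursion (explicit in `μ_4(d)` through the Fisher–Sykes cubic, …MemorySixStrict) turns the
recursion into `Φ(extensions of S) ≤ μ_4 · Φ(S)`.  The DEFICIT: every memory-4 word `w` (last step `r`, any `b ⟂ r`)
has the memory-4 continuation `w · r r b b r⁻ b⁻ b⁻` (`hexagon_continuation`: seven admissible steps, ending straight,
injective in `w`) whose last six steps close the `1 × 2` rectangle — a return at gap `6`, so the continuation is NOT a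
memory-6 word.  Removing these continuations from the seventh extension of the memory-6 words costs the potential a
fixed fraction, whence `c_{n+7,6}`-growth `≤ μ_4⁷ − 1 < μ_4⁷` per seven steps (…MemorySixStrict).

CONTENTS: `isMemFour_wordInit'`; the partition `card_filter_endABC` of a set of memory-4 words by end class; the three
restricted inequalities; `hexagon_continuation`.

HONEST FRAMING: elementary combinatorics (Fisher–Sykes 1959 App. A; Madras–Slade §1.2) organised for a Perron–Frobenius
deficit argument; nothing here is used by a certified `p_c` cell.  Written by prim-pcint-2 gen 17 (prover-prim-pcint-2-g17-0),
2026-08-25.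
-/

noncomputable section

open Filter Topology
open Literature.Probability.LatticeModels Literature.Probability.Percolation
open Literature.Probability.RandomPlanarGeometry.SAW.Zd (endA endB endC EndTurn EndU)
open Literature.Probability.FitznerVanDerHofstad2017 (wordSnoc wordSnoc_apply_of_lt wordSnoc_last wordInit_wordSnoc)
open Summit.CriticalPhenomena.PercolationContinuityZ3.Theorems.Pcint

namespace Summit.CriticalPhenomena.PercolationContinuityZ3.Theorems.Pcint.MemoryTail

variable {d : ℕ}

/-! ### Prefixes and the end-class partition of a set of memory-4 words -/

/-- The prefix of a memory-4 word is a memory-4 word. [cite: MadrasSlade1993, §1.2] -/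
theorem isMemFour_wordInit' {n : ℕ} {w : Fin (n + 1) → Fin d × Bool} (h : IsMemFour w) : IsMemFour (wordInit w) :=
  ⟨fun k hk => h.1 k (by omega), fun k hk => h.2 k (by omega)⟩

/-- **The end classes partition any set of memory-4 words**: `#S = #(S ∩ A) + #(S ∩ B) + #(S ∩ C)`. [folklore] -/
theorem card_filter_endABC {n : ℕ} (S : Finset (Fin (n + 3) → Fin d × Bool)) (hS : S ⊆ memFourWords d (n + 3)) :
    (S.filter fun w => w ∈ endA d n).card + (S.filter fun w => w ∈ endB d n).card
      + (S.filter fun w => w ∈ endC d n).card = S.card := by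
  classical
  have hA : (S.filter fun w => w ∈ endA d n) = S.filter fun w => ¬ EndTurn w := by
    ext w
    simp only [Finset.mem_filter, endA, and_congr_right_iff]
    exact fun hw => ⟨fun h => h.2, fun h => ⟨hS hw, h⟩⟩
  have hB : (S.filter fun w => w ∈ endB d n) = (S.filter fun w => EndTurn w).filter fun w => ¬ EndU w := by
    ext w
    simp only [Finset.mem_filter, endB, and_assoc, and_congr_right_iff]
    exact fun hw => ⟨fun h => h.2, fun h => ⟨hS hw, h⟩⟩
  have hC : (S.filter fun w => w ∈ endC d n) = (S.filter fun w => EndTurn w).filter fun w => EndU w := by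
    ext w
    simp only [Finset.mem_filter, endC, and_assoc, and_congr_right_iff]
    refine fun hw => ⟨fun h => ⟨?_, h.2⟩, fun h => ⟨hS hw, h.2⟩⟩
    unfold EndTurn; rw [h.2.2]; exact fun e => h.2.1 (by simpa [srev] using e.symm)
  rw [hA, hB, hC, add_assoc, add_comm ((S.filter fun w => EndTurn w).filter fun w => ¬ EndU w).card,
    Finset.card_filter_add_card_filter_not, add_comm, Finset.card_filter_add_card_filter_not]

/-! ### The Fisher–Sykes upper recursion restricted to a set of prefixes -/

/-- **`A`-extensions of `S` number at most `#S`**: a word ending straight is determined by its prefix.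
[cite: MadrasSlade1993, §1.2, eq. (1.2.14)] -/
theorem card_endA_succ_filter_le {n : ℕ} (S : Finset (Fin (n + 3) → Fin d × Bool)) :
    ((endA d (n + 1)).filter fun w => wordInit w ∈ S).card ≤ S.card := by
  classical
  refine Finset.card_le_card_of_injOn (fun w => wordInit w) (fun w hw => ?_) (fun w hw w' hw' h => ?_)
  · rw [Finset.mem_coe, Finset.mem_filter] at hw
    exact hw.2
  · rw [Finset.mem_coe, Finset.mem_filter, endA, Finset.mem_filter, mem_memFourWords] at hw hw'
    have key : ∀ {u : Fin (n + 4) → Fin d × Bool}, IsMemFour u → ¬ EndTurn u →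
        u ⟨n + 3, by omega⟩ = u ⟨n + 2, by omega⟩ := by
      intro u hu ht
      unfold EndTurn at ht
      rw [not_ne_iff] at ht
      exact eq_of_fst_eq_of_ne_srev' ht (hu.1 (n + 2) (by omega))
    apply wordInit_last_injective (n + 3)
    refine Prod.ext h ?_
    show w ⟨n + 3, _⟩ = w' ⟨n + 3, _⟩
    rw [key hw.1.1 hw.1.2, key hw'.1.1 hw'.1.2]
    have := congrFun h ⟨n + 2, by omega⟩
    simpa [wordInit] using this

/-- **`C`-extensions of `S` number at most `#(S ∩ B)`**: removing the last step of a U-turn word leaves a word of `S`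
ending in a turn which is not a U-turn, and the removed step is determined. [cite: MadrasSlade1993, §1.2, eq. (1.2.14)] -/
theorem card_endC_succ_filter_le {n : ℕ} (S : Finset (Fin (n + 3) → Fin d × Bool)) :
    ((endC d (n + 1)).filter fun w => wordInit w ∈ S).card ≤ (S.filter fun u => u ∈ endB d n).card := by
  classical
  refine Finset.card_le_card_of_injOn (fun w => wordInit w) (fun w hw => ?_) (fun w hw w' hw' h => ?_)
  · rw [Finset.mem_coe, Finset.mem_filter, endC, Finset.mem_filter, mem_memFourWords] at hw
    obtain ⟨⟨hm, hu⟩, hwS⟩ := hw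
    rw [Finset.mem_coe, Finset.mem_filter, endB, Finset.mem_filter, mem_memFourWords]
    refine ⟨hwS, isMemFour_wordInit' hm, ?_, ?_⟩
    · unfold EndTurn
      simpa [wordInit] using hu.1
    · intro hu'
      obtain ⟨_, h2'⟩ := hu'
      simp only [wordInit] at h2'
      exact hm.2 n (by omega) ⟨h2', hu.2⟩
  · rw [Finset.mem_coe, Finset.mem_filter, endC, Finset.mem_filter] at hw hw'
    apply wordInit_last_injective (n + 3)
    refine Prod.ext h ?_
    show w ⟨n + 3, _⟩ = w' ⟨n + 3, _⟩
    rw [hw.1.2.2, hw'.1.2.2]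
    have := congrFun h ⟨n + 1, by omega⟩
    simp only [wordInit] at this
    rw [this]

/-- **`B`-extensions of `S` number at most `(2d−2)·#(S ∩ A) + (2d−3)·(#(S ∩ B) + #(S ∩ C))`**: after a straight end any of
the `2d − 2` turning steps may follow; after a turn the reverse of the second-to-last step would give a U-turn.
[cite: MadrasSlade1993, §1.2, eq. (1.2.14)] -/
theorem card_endB_succ_filter_le {n : ℕ} (S : Finset (Fin (n + 3) → Fin d × Bool))
    (hS : S ⊆ memFourWords d (n + 3)) :
    ((endB d (n + 1)).filter fun w => wordInit w ∈ S).card ≤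
      (2 * d - 2) * (S.filter fun u => u ∈ endA d n).card +
        (2 * d - 3) * ((S.filter fun u => u ∈ endB d n).card + (S.filter fun u => u ∈ endC d n).card) := by
  classical
  -- admissible turning steps after the prefix `u`
  let allowed : (Fin (n + 3) → Fin d × Bool) → Finset (Fin d × Bool) := fun u =>
    if EndTurn u then
      ((Finset.univ : Finset (Fin d × Bool)).filter fun a => a.1 ≠ (u ⟨n + 2, by omega⟩).1).erase
        (srev (u ⟨n + 1, by omega⟩))
    else (Finset.univ : Finset (Fin d × Bool)).filter fun a => a.1 ≠ (u ⟨n + 2, by omega⟩).1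
  have hcard : ∀ u : Fin (n + 3) → Fin d × Bool, (allowed u).card = if EndTurn u then 2 * d - 3 else 2 * d - 2 := by
    intro u
    simp only [allowed]
    split_ifs with h
    · rw [Finset.card_erase_of_mem, card_filter_fst_ne']
      · omega
      · rw [Finset.mem_filter]
        refine ⟨Finset.mem_univ _, ?_⟩
        show (u ⟨n + 1, _⟩).1 ≠ (u ⟨n + 2, _⟩).1
        exact fun e => h e.symm
    · exact card_filter_fst_ne' _
  set F : (Fin (n + 4) → Fin d × Bool) → (Σ _ : Fin (n + 3) → Fin d × Bool, Fin d × Bool) :=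
    fun w => ⟨wordInit w, w ⟨n + 3, by omega⟩⟩ with hF
  set T := S.sigma fun u => allowed u with hT
  have hmaps : Set.MapsTo F (((endB d (n + 1)).filter fun w => wordInit w ∈ S) : Set _) (T : Set _) := by
    intro w hw
    rw [Finset.mem_coe, Finset.mem_filter, endB, Finset.mem_filter, mem_memFourWords] at hw
    obtain ⟨⟨hm, ht, hu⟩, hwS⟩ := hw
    rw [Finset.mem_coe, hT, Finset.mem_sigma]
    refine ⟨hwS, ?_⟩
    simp only [hF, allowed]
    have hoff : (w ⟨n + 3, by omega⟩).1 ≠ (wordInit w ⟨n + 2, by omega⟩).1 := by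
      simpa [wordInit, EndTurn] using ht
    split_ifs with hturn
    · rw [Finset.mem_erase, Finset.mem_filter]
      refine ⟨?_, Finset.mem_univ _, hoff⟩
      intro heq
      apply hu
      refine ⟨?_, ?_⟩
      · simpa [wordInit, EndTurn] using hturn
      · simpa [wordInit] using heq
    · rw [Finset.mem_filter]
      exact ⟨Finset.mem_univ _, hoff⟩
  have hinj : Set.InjOn F (((endB d (n + 1)).filter fun w => wordInit w ∈ S) : Set _) := by
    intro w _ w' _ h
    simp only [hF, Sigma.mk.injEq, heq_eq_eq] at h
    exact wordInit_last_injective (n + 3) (Prod.ext h.1 h.2)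
  have hSA : (S.filter fun u => ¬ EndTurn u) = S.filter fun u => u ∈ endA d n := by
    ext u
    simp only [Finset.mem_filter, endA, and_congr_right_iff]
    exact fun hu => ⟨fun h => ⟨hS hu, h⟩, fun h => h.2⟩
  have hST : (S.filter fun u => EndTurn u).card ≤
      (S.filter fun u => u ∈ endB d n).card + (S.filter fun u => u ∈ endC d n).card := by
    have hsub : (S.filter fun u => EndTurn u) ⊆ (S.filter fun u => u ∈ endB d n) ∪ (S.filter fun u => u ∈ endC d n) := by
      intro u hu
      rw [Finset.mem_filter] at hu
      simp only [endB, endC, Finset.mem_union, Finset.mem_filter]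
      by_cases h : EndU u
      · exact Or.inr ⟨hu.1, hS hu.1, h⟩
      · exact Or.inl ⟨hu.1, hS hu.1, hu.2, h⟩
    exact (Finset.card_le_card hsub).trans (Finset.card_union_le _ _)
  calc ((endB d (n + 1)).filter fun w => wordInit w ∈ S).card ≤ T.card := Finset.card_le_card_of_injOn F hmaps hinj
    _ = ∑ u ∈ S, (allowed u).card := Finset.card_sigma _ _
    _ = ∑ u ∈ S, (if EndTurn u then 2 * d - 3 else 2 * d - 2) := Finset.sum_congr rfl fun u _ => hcard u
    _ = (2 * d - 3) * (S.filter fun u => EndTurn u).card + (2 * d - 2) * (S.filter fun u => ¬ EndTurn u).card := by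
        rw [Finset.sum_ite, Finset.sum_const, Finset.sum_const, smul_eq_mul, smul_eq_mul]
        ring
    _ ≤ (2 * d - 2) * (S.filter fun u => u ∈ endA d n).card +
          (2 * d - 3) * ((S.filter fun u => u ∈ endB d n).card + (S.filter fun u => u ∈ endC d n).card) := by
        rw [hSA, add_comm]
        exact Nat.add_le_add_left (Nat.mul_le_mul_left _ hST) _

/-! ### The hexagon continuation -/

/-- A step off the axis of `r` is neither `r` nor its reverse. [folklore] -/
theorem ne_srev_of_fst_ne {r b : Fin d × Bool} (h : b.1 ≠ r.1) : b ≠ srev r := fun e => h (by rw [e]; rfl)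

/-- **The hexagon continuation.**  For `d ≥ 2` there is a map `c` sending each word `w` of length `n + 3` (last step
`r`; `b` a fixed step off the axis of `r`) to the word `w · r r b b r⁻ b⁻ b⁻` of length `n + 10` such that: `c` is
injective and `w` is the prefix of `c w`; if `w` has memory 4 then so has `c w` (the seven appended steps contain no
reversal and close no unit square); `c w` ends straight (end class `A`); and `c w` does NOT have memory 6 — its sites at
times `n + 4` and `n + 10` coincide (the steps `r b b r⁻ b⁻ b⁻` close the `1 × 2` rectangle). [folklore] -/
theorem hexagon_continuation (hd : 2 ≤ d) (n : ℕ) :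
    ∃ c : (Fin (n + 3) → Fin d × Bool) → (Fin (n + 10) → Fin d × Bool),
      Function.Injective c ∧
      (∀ w (i : Fin (n + 3)), c w ⟨i.1, by omega⟩ = w i) ∧
      (∀ w, IsMemFour w → IsMemFour (c w)) ∧
      (∀ w, ¬ EndTurn (n := n + 7) (c w)) ∧
      (∀ w, ¬ IsMem 6 (c w)) := by
  classical
  -- a step off the axis of `r`
  let turn : Fin d × Bool → Fin d × Bool := fun r =>
    if r.1 = ⟨0, by omega⟩ then (⟨1, by omega⟩, true) else (⟨0, by omega⟩, true)
  have hturn : ∀ r, (turn r).1 ≠ r.1 := by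
    intro r
    by_cases h : r.1 = ⟨0, by omega⟩
    · simp only [turn, h, if_true]; exact fun e => absurd (congrArg Fin.val e) (by simp)
    · simp only [turn, h, if_false]; exact fun e => h e.symm
  -- the continuation, letter by letter
  let c : (Fin (n + 3) → Fin d × Bool) → (Fin (n + 10) → Fin d × Bool) := fun w i =>
    if h : i.1 < n + 3 then w ⟨i.1, h⟩
    else if i.1 < n + 5 then w ⟨n + 2, by omega⟩
    else if i.1 < n + 7 then turn (w ⟨n + 2, by omega⟩)
    else if i.1 = n + 7 then srev (w ⟨n + 2, by omega⟩)
    else srev (turn (w ⟨n + 2, by omega⟩))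
  -- its letters
  have c_lt : ∀ w (i : ℕ) (hi : i < n + 3), c w ⟨i, by omega⟩ = w ⟨i, hi⟩ := fun w i hi => by
    simp [c, hi]
  have c_r : ∀ w (i : ℕ) (hi : i < n + 10), n + 3 ≤ i → i < n + 5 → c w ⟨i, hi⟩ = w ⟨n + 2, by omega⟩ :=
    fun w i hi h1 h2 => by simp [c, show ¬ (i < n + 3) by omega, h2]
  have c_b : ∀ w (i : ℕ) (hi : i < n + 10), n + 5 ≤ i → i < n + 7 → c w ⟨i, hi⟩ = turn (w ⟨n + 2, by omega⟩) :=
    fun w i hi h1 h2 => by simp [c, show ¬ (i < n + 3) by omega, show ¬ (i < n + 5) by omega, h2]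
  have c_7 : ∀ w (i : ℕ) (hi : i < n + 10), i = n + 7 → c w ⟨i, hi⟩ = srev (w ⟨n + 2, by omega⟩) :=
    fun w i hi h => by
      simp [c, h]
  have c_8 : ∀ w (i : ℕ) (hi : i < n + 10), n + 8 ≤ i → c w ⟨i, hi⟩ = srev (turn (w ⟨n + 2, by omega⟩)) :=
    fun w i hi h => by
      simp [c, show ¬ (i < n + 3) by omega, show ¬ (i < n + 5) by omega, show ¬ (i < n + 7) by omega,
        show i ≠ n + 7 by omega]
  refine ⟨c, ?_, fun w i => c_lt w i.1 i.2, ?_, ?_, ?_⟩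
  · -- injective: compare prefixes
    intro w w' h
    funext i
    rw [← c_lt w i.1 i.2, ← c_lt w' i.1 i.2, h]
  · -- memory 4 is kept
    intro w hw
    set r := w ⟨n + 2, by omega⟩ with hr
    set b := turn r with hb
    have hb1 : b.1 ≠ r.1 := hturn r
    have hbr : b ≠ srev r := ne_srev_of_fst_ne hb1
    have hrb : srev r ≠ srev b := fun e =>
      hb1 (congrArg Prod.fst (Literature.Probability.Percolation.srev_injective e)).symm
    have hbr' : srev b ≠ r := fun e => hb1 (by rw [← e]; rfl)
    refine ⟨fun k hk => ?_, fun k hk => ?_⟩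
    · -- no reversal at positions k, k+1
      by_cases h1 : k + 1 < n + 3
      · rw [c_lt w (k + 1) h1, c_lt w k (by omega)]; exact hw.1 k h1
      rcases (show k = n + 2 ∨ k = n + 3 ∨ k = n + 4 ∨ k = n + 5 ∨ k = n + 6 ∨ k = n + 7 ∨ k = n + 8 by omega)
        with rfl | rfl | rfl | rfl | rfl | rfl | rfl
      · rw [c_r w (n + 2 + 1) hk (by omega) (by omega), c_lt w (n + 2) (by omega)]
        exact (srev_ne_self _).symm
      · rw [c_r w (n + 3 + 1) hk (by omega) (by omega), c_r w (n + 3) (by omega) (by omega) (by omega)]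
        exact (srev_ne_self _).symm
      · rw [c_b w (n + 4 + 1) hk (by omega) (by omega), c_r w (n + 4) (by omega) (by omega) (by omega)]
        exact hbr
      · rw [c_b w (n + 5 + 1) hk (by omega) (by omega), c_b w (n + 5) (by omega) (by omega) (by omega)]
        exact (srev_ne_self _).symm
      · rw [c_7 w (n + 6 + 1) hk (by omega), c_b w (n + 6) (by omega) (by omega) (by omega)]
        exact hrb
      · rw [c_8 w (n + 7 + 1) hk (by omega), c_7 w (n + 7) (by omega) rfl, Literature.Probability.Percolation.srev_srev]
        exact hbr'
      · rw [c_8 w (n + 8 + 1) hk (by omega), c_8 w (n + 8) (by omega) (by omega)]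
        exact (srev_ne_self _).symm
    · -- no unit square at positions k, …, k+3
      by_cases h3 : k + 3 < n + 3
      · rw [c_lt w (k + 3) h3, c_lt w (k + 2) (by omega), c_lt w (k + 1) (by omega), c_lt w k (by omega)]
        exact hw.2 k h3
      rcases (show k = n ∨ k = n + 1 ∨ k = n + 2 ∨ k = n + 3 ∨ k = n + 4 ∨ k = n + 5 ∨ k = n + 6 by omega)
        with rfl | rfl | rfl | rfl | rfl | rfl | rfl
      · rw [c_lt w (k + 2) (by omega), c_lt w k (by omega), c_r w (k + 3) hk (by omega) (by omega),
          c_lt w (k + 1) (by omega)]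
        rintro ⟨-, h2⟩
        exact hw.1 (k + 1) (by omega) h2
      · rw [c_r w (n + 1 + 3) hk (by omega) (by omega), c_lt w (n + 1 + 1) (by omega)]
        rintro ⟨-, h2⟩
        exact srev_ne_self _ h2.symm
      · rw [c_r w (n + 2 + 2) (by omega) (by omega) (by omega), c_lt w (n + 2) (by omega)]
        rintro ⟨h1, -⟩
        exact srev_ne_self _ h1.symm
      · rw [c_b w (n + 3 + 2) (by omega) (by omega) (by omega), c_r w (n + 3) (by omega) (by omega) (by omega)]
        rintro ⟨h1, -⟩
        exact hbr h1
      · rw [c_b w (n + 4 + 2) (by omega) (by omega) (by omega), c_r w (n + 4) (by omega) (by omega) (by omega)]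
        rintro ⟨h1, -⟩
        exact hbr h1
      · rw [c_7 w (n + 5 + 2) (by omega) (by omega), c_b w (n + 5) (by omega) (by omega) (by omega)]
        rintro ⟨h1, -⟩
        exact hrb h1
      · rw [c_8 w (n + 6 + 3) hk (by omega), c_7 w (n + 6 + 1) (by omega) (by omega),
          Literature.Probability.Percolation.srev_srev]
        rintro ⟨-, h2⟩
        exact hbr' h2
  · -- the continuation ends straight
    intro w ht
    unfold EndTurn at ht
    exact ht (by rw [c_8 w (n + 7 + 2) (by omega) (by omega), c_8 w (n + 7 + 1) (by omega) (by omega)])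
  · -- the return at gap six
    intro w h6
    have hpre : ∀ k, k ≤ n + 3 → wordPos (c w) k = wordPos w k := by
      intro k hk
      induction k with
      | zero => simp
      | succ k ih =>
        rw [wordPos_succ (c w) (by omega : k < n + 10), wordPos_succ w (by omega : k < n + 3), ih (by omega),
          c_lt w k (by omega)]
    have h4 : wordPos (c w) (n + 4) = wordPos w (n + 3) + stepVec (w ⟨n + 2, by omega⟩) := by
      rw [wordPos_succ (c w) (by omega : n + 3 < n + 10), hpre (n + 3) le_rfl, c_r w (n + 3) (by omega) (by omega) (by omega)]
    have e5 : wordPos (c w) (n + 5) = wordPos (c w) (n + 4) + stepVec (c w ⟨n + 4, by omega⟩) :=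
      wordPos_succ (c w) (by omega)
    have e6 : wordPos (c w) (n + 6) = wordPos (c w) (n + 5) + stepVec (c w ⟨n + 5, by omega⟩) :=
      wordPos_succ (c w) (by omega)
    have e7 : wordPos (c w) (n + 7) = wordPos (c w) (n + 6) + stepVec (c w ⟨n + 6, by omega⟩) :=
      wordPos_succ (c w) (by omega)
    have e8 : wordPos (c w) (n + 8) = wordPos (c w) (n + 7) + stepVec (c w ⟨n + 7, by omega⟩) :=
      wordPos_succ (c w) (by omega)
    have e9 : wordPos (c w) (n + 9) = wordPos (c w) (n + 8) + stepVec (c w ⟨n + 8, by omega⟩) :=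
      wordPos_succ (c w) (by omega)
    have e10 : wordPos (c w) (n + 10) = wordPos (c w) (n + 9) + stepVec (c w ⟨n + 9, by omega⟩) :=
      wordPos_succ (c w) (by omega)
    have h10 : wordPos (c w) (n + 10) = wordPos w (n + 3) + stepVec (w ⟨n + 2, by omega⟩) := by
      rw [e10, e9, e8, e7, e6, e5, h4, c_r w (n + 4) (by omega) (by omega) (by omega),
        c_b w (n + 5) (by omega) (by omega) (by omega), c_b w (n + 6) (by omega) (by omega) (by omega),
        c_7 w (n + 7) (by omega) rfl, c_8 w (n + 8) (by omega) (by omega), c_8 w (n + 9) (by omega) (by omega),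
        stepVec_srev, stepVec_srev]
      abel
    exact h6 (n + 4) (n + 10) le_rfl (by omega) (by omega) (by rw [h4, h10])

end Summit.CriticalPhenomena.PercolationContinuityZ3.Theorems.Pcint.MemoryTail
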